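import Summits.QuantumFields.YangMills.Theorems.UnitScaleTiltProp7SymCentreAbelianFibre
import HarnessLib

/-!
# Route `UnitScaleTilt`, crux K1 child «MinimiserStabilityRegPr» (stmt-QuantumFields-19200), stub `stub_existenceMinimalOrbit` (EX), cure (ii-a) line «SYM-CENTRE» —
# «FLUX-REGPR»: PRINT'S REGULAR SPACE FOR A DIAGONAL CONFIGURATION WHOSE LATTICE CURL IS SMALL ONLY MODULO `2πℤ` (the flux sector's `RegPr` row) — cell `ym3-torus`,
# width seat `ym-ust-20520-w5` (g8)

WHY.  ★px19's ✓`regPr_gexpAt_of_curl_rows` (R4-DICT) reads the sup and Lipschitz rows of the REAL curl `curlAt θ`; the flux-sector lift `a = liftL θ′ + 2π·Σ q_{μν} w_{μν}` (✓`exists_fluxLift`)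
carries the INTEGER defects `−2πq` on the wrap-corner plaquettes, so its raw curl rows fail there although the `SU(2)` field `b ↦ e^{a(b)·iσ₃}` does not see them (`e^{2πiq} = 1`,
★w4's ✓`gexp_I_smul_sigma3_add_two_pi_mul_int`).  THIS FILE is the `2πℤ`-periodic twin, for the diagonal direction `Y = iσ₃` only (periodicity needs the integer spectrum): every row is
read on the REAL PART `curlAt a − 2π·z` for an arbitrary INTEGER 2-cochain `z`.  §1 `coe_gexp_sigma3_eq_of_int` (`e^{t·iσ₃} = e^{(t − 2πz)·iσ₃}`), ★`dist1_plaqHol_gexpAt_sigma3_le_modZ`,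
★`plaqSmall_gexpAt_sigma3_modZ`; §2 ★`norm_covDivT_one_gexpAt_sigma3_le_modZ` (the divergence clause from the Lipschitz row of the real part); §3 ★★★`regPr_gexpAt_sigma3_of_curl_rows_modZ`.
HONEST FRAMING.  Kernel bookkeeping over ★px19's dictionary and ★w4's periodicity; no estimate of [7]∕[4]; nothing of EX∕the crux∕`hSymCentre` proved or claimed; count-neutral helper
(`--supports stmt-QuantumFields-19200 --as helper`); def-free; every landed file untouched.  YM₃ on the torus is a RUNG (R3) of the programme, not the Clay problem; no claim about
d = 4, infinite volume or a mass gap.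

References: T. Bałaban, Commun. Math. Phys. 102 (1985) 277–309 [Balaban1985Variational] ((2), (6) p.278: the regular space); Commun. Math. Phys. 99 (1985) 75–102 [Balaban1985RegularSpaces]
((1.7), (1.9) p.77); Commun. Math. Phys. 98 (1985) 17–51 [Balaban1985Averaging] ((9) p.19, (24) p.21).
-/

set_option autoImplicit false

noncomputable section

open scoped Matrix.Norms.L2Operator

namespace Summit.QuantumFields.YangMills.Theorems.Prop7SymCentreFluxRegPr

open NormedSpace Finset
open Literature.MathematicalPhysics.QuantumFieldTheory.Balaban1983to89
open Literature.MathematicalPhysics.QuantumFieldTheory.Balaban1983to89.B10Eq27TorusAxialLog (unitsField toUField)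
open Literature.MathematicalPhysics.QuantumFieldTheory.Balaban1983to89.B10Eq68TorusRegularity (covDivT covDerivT plaqFT)
open Literature.MathematicalPhysics.QuantumFieldTheory.Balaban1983to89.T3ContinuumYM3Torus
open Literature.MathematicalPhysics.QuantumFieldTheory.Balaban1983to89.T3RegularMinimiser (regThreshold)
open Literature.MathematicalPhysics.QuantumFieldTheory.Balaban1983to89.T3PrintedRegularMinimiser (RegPr DivSmall)
open Literature.MathematicalPhysics.QuantumFieldTheory.Balaban1983to89.B9AdOrthogonal (σ₃)
open Summit.QuantumFields.Balaban3D.Carriers (suGroupModel)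
open Summit.QuantumFields.YangMills.Theorems.BalabanUVNodesN08AlphaAbelianLift (gexp)
open Summit.QuantumFields.YangMills.Theorems.AbelianEML (gexpAt curlAt plaqHol_gexpAt coe_gexp_su)
open Summit.QuantumFields.YangMills.Theorems.Prop7SymCentreAbelianDict (I_smul_sigma3_mem_lie norm_I_smul_sigma3_le_one norm_exp_smul_sub_one_le
  norm_exp_smul_sub_exp_smul_le plaqHol_gexpAt_curlAt covDerivT_one_gexpAt)
open Summit.QuantumFields.YangMills.Theorems.Prop7SymCentreAbelianFibre (gexp_I_smul_sigma3_add_two_pi_mul_int)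

variable {P : Params} {j : ℕ}

/-! ## §1 The plaquette clause modulo `2πℤ` -/

/-- **PERIODICITY, READ IN `M₂(ℂ)`**: `e^{t·iσ₃} = e^{(t − 2πz)·iσ₃}` for every integer `z`. [folklore] -/
theorem coe_gexp_sigma3_eq_of_int (t : ℝ) (z : ℤ) :
    exp ((((t : ℝ)) : ℂ) • (Complex.I • σ₃ : Matrix (Fin 2) (Fin 2) ℂ)) = exp (((((t - 2 * Real.pi * z : ℝ))) : ℂ) • (Complex.I • σ₃ : Matrix (Fin 2) (Fin 2) ℂ)) := by
  rw [← coe_gexp_su I_smul_sigma3_mem_lie, ← coe_gexp_su I_smul_sigma3_mem_lie]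
  have h := gexp_I_smul_sigma3_add_two_pi_mul_int (t - 2 * Real.pi * z) z
  rw [show t - 2 * Real.pi * (z : ℝ) + 2 * Real.pi * (z : ℝ) = t by ring] at h
  rw [h]

/-- **★ `dist1 (U(∂p)) ≤ |curlAt θ p − 2π·z|`** for the diagonal configuration and ANY integer `z` (the plaquette variable does not see integer fluxes; `‖iσ₃‖ ≤ 1`).
[cite: Balaban1985Averaging, (19)+(24) p.21] -/
theorem dist1_plaqHol_gexpAt_sigma3_le_modZ (θ : PBond P j → ℝ) (p : Plaq P j) (z : ℤ) :
    dist1 (GaugeField.plaqHol (gexpAt (suGroupModel 2) I_smul_sigma3_mem_lie θ) p) ≤ |curlAt θ p.src p.μ p.ν - 2 * Real.pi * z| := by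
  rw [plaqHol_gexpAt_curlAt I_smul_sigma3_mem_lie,
    show dist1 (gexp (suGroupModel 2) I_smul_sigma3_mem_lie (curlAt θ p.src p.μ p.ν))
      = ‖((gexp (suGroupModel 2) I_smul_sigma3_mem_lie (curlAt θ p.src p.μ p.ν) : Matrix.specialUnitaryGroup (Fin 2) ℂ) : Matrix (Fin 2) (Fin 2) ℂ) - 1‖ from rfl,
    coe_gexp_su I_smul_sigma3_mem_lie, coe_gexp_sigma3_eq_of_int _ z]
  calc _ ≤ |curlAt θ p.src p.μ p.ν - 2 * Real.pi * z| * ‖(Complex.I • σ₃ : Matrix (Fin 2) (Fin 2) ℂ)‖ := norm_exp_smul_sub_one_le I_smul_sigma3_mem_lie _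
    _ ≤ |curlAt θ p.src p.μ p.ν - 2 * Real.pi * z| * 1 := mul_le_mul_of_nonneg_left norm_I_smul_sigma3_le_one (abs_nonneg _)
    _ = _ := mul_one _

/-- **★ THE PLAQUETTE CLAUSE FROM THE SUP ROW OF THE REAL PART**: `|curlAt θ − 2π·z| ≤ δ₁ < ε` (any integer 2-cochain `z`) ⇒ `PlaqSmall ε (b ↦ e^{θ(b)·iσ₃})`.
[cite: Balaban1985Variational, (2) p.278; Balaban1985Averaging, (24) p.21] -/
theorem plaqSmall_gexpAt_sigma3_modZ (θ : PBond P j → ℝ) (z : Site P j → Fin P.d → Fin P.d → ℤ) {δ₁ ε : ℝ}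
    (hθ : ∀ (x : Site P j) (μ ν : Fin P.d), μ ≠ ν → |curlAt θ x μ ν - 2 * Real.pi * z x μ ν| ≤ δ₁) (hε : δ₁ < ε) :
    PlaqSmall ε (gexpAt (suGroupModel 2) I_smul_sigma3_mem_lie θ) := fun p =>
  ((dist1_plaqHol_gexpAt_sigma3_le_modZ θ p (z p.src p.μ p.ν)).trans (hθ p.src p.μ p.ν p.hμν.ne)).trans_lt hε

/-! ## §2 The divergence clause modulo `2πℤ` -/

variable {s : ℕ}

/-- **★ THE DIVERGENCE CLAUSE FROM THE LIPSCHITZ ROW OF THE REAL PART**: if `|(curlAt θ − 2πz)(x + e_λ; κμ) − (curlAt θ − 2πz)(x; κμ)| ≤ δ₂` (any integer 2-cochain `z`) then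
`‖(D^{1*}_U ∂U)_μ(x)‖ ≤ (d−1)·δ₂` for `U = (b ↦ e^{θ(b)·iσ₃})`. [cite: Balaban1985RegularSpaces, (1.2) p.76, (1.9) p.77; Balaban1985Averaging, (24) p.21] -/
theorem norm_covDivT_one_gexpAt_sigma3_le_modZ (θ : PBond P s → ℝ) (z : Site P s → Fin P.d → Fin P.d → ℤ) {δ₂ : ℝ}
    (hLip : ∀ (x : Site P s) (lam κ μ : Fin P.d), κ ≠ μ →
      |(curlAt θ (x.shift lam) κ μ - 2 * Real.pi * z (x.shift lam) κ μ) - (curlAt θ x κ μ - 2 * Real.pi * z x κ μ)| ≤ δ₂) (μ : Fin P.d) (x : Site P s) :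
    ‖covDivT 1 (unitsField (toUField (gexpAt (suGroupModel 2) I_smul_sigma3_mem_lie θ))) μ x‖ ≤ ((P.d - 1 : ℕ) : ℝ) * δ₂ := by
  have hY := I_smul_sigma3_mem_lie
  have hterm : ∀ ν κ μ' : Fin P.d, κ ≠ μ' →
      ‖covDerivT 1 (unitsField (toUField (gexpAt (suGroupModel 2) hY θ))) ν (plaqFT (unitsField (toUField (gexpAt (suGroupModel 2) hY θ))) κ μ') x‖ ≤ δ₂ := by
    intro ν κ μ' hne
    rw [covDerivT_one_gexpAt hY, coe_gexp_sigma3_eq_of_int (curlAt θ (x.unshift ν) κ μ') (z (x.unshift ν) κ μ'),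
      coe_gexp_sigma3_eq_of_int (curlAt θ x κ μ') (z x κ μ')]
    have h := hLip (x.unshift ν) ν κ μ' hne
    rw [Site.shift_unshift, abs_sub_comm] at h
    calc _ ≤ |(curlAt θ (x.unshift ν) κ μ' - 2 * Real.pi * z (x.unshift ν) κ μ') - (curlAt θ x κ μ' - 2 * Real.pi * z x κ μ')| *
          ‖(Complex.I • σ₃ : Matrix (Fin 2) (Fin 2) ℂ)‖ := norm_exp_smul_sub_exp_smul_le hY _ _
      _ ≤ δ₂ * 1 := mul_le_mul h norm_I_smul_sigma3_le_one (norm_nonneg _) ((abs_nonneg _).trans h)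
      _ = δ₂ := mul_one _
  unfold covDivT
  calc _ ≤ ‖∑ ν ∈ Finset.Iio μ, covDerivT 1 (unitsField (toUField (gexpAt (suGroupModel 2) hY θ))) ν (plaqFT (unitsField (toUField (gexpAt (suGroupModel 2) hY θ))) ν μ) x‖
        + ‖∑ ν ∈ Finset.Ioi μ, covDerivT 1 (unitsField (toUField (gexpAt (suGroupModel 2) hY θ))) ν (plaqFT (unitsField (toUField (gexpAt (suGroupModel 2) hY θ))) μ ν) x‖ :=
        norm_sub_le _ _
    _ ≤ ∑ ν ∈ Finset.Iio μ, ‖covDerivT 1 (unitsField (toUField (gexpAt (suGroupModel 2) hY θ))) ν (plaqFT (unitsField (toUField (gexpAt (suGroupModel 2) hY θ))) ν μ) x‖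
        + ∑ ν ∈ Finset.Ioi μ, ‖covDerivT 1 (unitsField (toUField (gexpAt (suGroupModel 2) hY θ))) ν (plaqFT (unitsField (toUField (gexpAt (suGroupModel 2) hY θ))) μ ν) x‖ :=
        add_le_add (norm_sum_le _ _) (norm_sum_le _ _)
    _ ≤ ∑ _ν ∈ Finset.Iio μ, δ₂ + ∑ _ν ∈ Finset.Ioi μ, δ₂ :=
        add_le_add (sum_le_sum fun ν hν => hterm ν ν μ (ne_of_lt (Finset.mem_Iio.mp hν)))
          (sum_le_sum fun ν hν => hterm ν μ ν (ne_of_lt (Finset.mem_Ioi.mp hν)))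
    _ = (((Finset.Iio μ).card : ℝ) + ((Finset.Ioi μ).card : ℝ)) * δ₂ := by
        rw [sum_const, sum_const, nsmul_eq_mul, nsmul_eq_mul]; ring
    _ = ((P.d - 1 : ℕ) : ℝ) * δ₂ := by
        rw [Fin.card_Iio, Fin.card_Ioi, ← Nat.cast_add]
        congr 2
        have := μ.isLt
        omega

/-! ## §3 The T³ series: `RegPr` of the flux-sector configuration -/

/-- **★★★ «FLUX-REGPR»** — for the T³ series `F`, run `K`, comparison height `n`: if the REAL PART `curlAt a − 2π·z` of the lattice curl of the fine one-form `a` (any INTEGER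
2-cochain `z` — the flux defects) has sup `≤ δ₁ < ε₀L^{−2(K−n)}` and Lipschitz constant `δ₂` with `(d−1)·δ₂ < ε₀L^{−3(K−n)}`, then `b ↦ e^{a(b)·iσ₃}` lies in `𝔘_{K−n}(ε₀)`:
`RegPr F n K ε₀ (gexpAt (suGroupModel 2) iσ₃ a)`. [cite: Balaban1985Variational, (2)+(6) p.278; Balaban1985RegularSpaces, (1.7)+(1.9) p.77] -/
theorem regPr_gexpAt_sigma3_of_curl_rows_modZ (F : T3Family) (n K : ℕ) (ε₀ : ℝ) (a : PBond (F.P K) 0 → ℝ)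
    (z : Site (F.P K) 0 → Fin (F.P K).d → Fin (F.P K).d → ℤ) {δ₁ δ₂ : ℝ}
    (h1 : ∀ (x : Site (F.P K) 0) (μ ν : Fin (F.P K).d), μ ≠ ν → |curlAt a x μ ν - 2 * Real.pi * z x μ ν| ≤ δ₁)
    (h2 : ∀ (x : Site (F.P K) 0) (lam μ ν : Fin (F.P K).d), μ ≠ ν →
      |(curlAt a (x.shift lam) μ ν - 2 * Real.pi * z (x.shift lam) μ ν) - (curlAt a x μ ν - 2 * Real.pi * z x μ ν)| ≤ δ₂)
    (hw1 : δ₁ < regThreshold F n K ε₀) (hw2 : (((F.P K).d - 1 : ℕ) : ℝ) * δ₂ < ε₀ * ((F.L : ℝ)⁻¹) ^ (3 * (K - n))) :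
    RegPr F n K ε₀ (gexpAt (suGroupModel 2) I_smul_sigma3_mem_lie a) :=
  ⟨plaqSmall_gexpAt_sigma3_modZ a z h1 hw1, fun b => (norm_covDivT_one_gexpAt_sigma3_le_modZ a z h2 b.dir b.src).trans_lt hw2⟩

end Summit.QuantumFields.YangMills.Theorems.Prop7SymCentreFluxRegPr

end
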